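import Literature.NumberTheory.ComplexMultiplication.SerreGroupLimitCMTypeGenerators
import Literature.NumberTheory.ComplexMultiplication.InducedReflex
import Literature.NumberTheory.ComplexMultiplication.SerreGroupNormMapPoints
import HarnessLib

/-!
# The level `X^*(S^K) ⊂ X^*(S)` in the two vocabularies of the tree: g13's `lambdaLevel K` (functions on `Γ = Gal(ℚ^{cm}/ℚ)` constant on the cosets
# of `Gal(ℚ^{cm}/K)`) IS skel-3's `infinityTypes Γ Hom_ℚ(K, ℚ^{cm}) ι`, transported along `σ ↦ σ|_K`
# (J. S. Milne, *Complex Multiplication*, Ch. I §4 pp. 40–43; Milne–Shih, LNM 900, Ch. III §1 (1.1)–(1.3))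

Family `hodge`, lane `lit-hodgefound` (Layer A3; seat `lit-hodgefound-p27`, generation 20, row g20-#3 FILE 1); topic
`Literature/NumberTheory/ComplexMultiplication`, namespace `Literature.NumberTheory.ComplexMultiplication.CMNumbers`.  Definitions WITH BODIES
(`resLevel`, `levelInclusion`, `levelChar`, `extendLevel`, and the instance-plumbing `isGalois_finiteGaloisLevel`) validated in-file by the theorems
below; no named fact (D-0026, net debt 0).  It closes the identification that g14's `SerreGroupLimitSplitting` lists as NOT done («the identification
of `Λ^K` with Q768's abstract `infinityTypes (L ≃ₐ[ℚ] L) (K →ₐ[ℚ] L) ι`»), and is the vocabulary bridge on which FILE 2 `WeilTorusToSerreGroupLimit`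
(Milne 1999 Rem. 5.2 (a) in the limit: one map `α : X^*(S) → W(p^∞)`) rests: the maps `α^K` of g16/g20 live on `infinityTypes Γ Hom(K, ℚ^{cm}) ι`
for abstract CM fields `K`, the limit `X^*(S) = infinityTypesCM = ⋃_K lambdaLevel K` of g13/g14 lives on functions on `Γ`.

THE PRINT.  [MilneCM2006] Ch. I §4 p. 40: «for `L ⊃ K`, `f ↦ f_L`, `f_L(τ) = f(τ|K)`, `I(K) → I(L)`»; p. 42: «The character group of `S` is
`I = lim→ I(K)`» (the tree: `infinityTypesCM`, `lambdaLevel`, `iSup_lambdaLevel`); Prop. 4.20: the norm maps `S^L → S^K` are `X^*` of `f ↦ f_L`.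
[MilneShih1982Taniyama] III §1 (1.1): `X^*(S^L) ⊂ X^*(L^×) = ℤ^{Hom(L, ℚ^{al})}` cut out by `(σ − 1)(ι + 1)χ = 0 = (ι + 1)(σ − 1)χ`; (1.3): transport
of structure along `Gal(ℚ^{al}/ℚ) → Hom(L, ℚ^{al})`, `σ ↦ σ|L`.

WHAT IS PROVED.
* §1 DEF `resLevel K : σ ↦ σ|_K`, the `Γ`-equivariant map `Gal(ℚ^{cm}/ℚ) → Hom_ℚ(K, ℚ^{cm})` for a level `K : IntermediateField ℚ cmNumbers`
  (`resLevel_surjective` — `ℚ^{cm}/ℚ` is normal; `resLevel_eq_iff` — the fibres are the left cosets of `Gal(ℚ^{cm}/K)`; `resEmb_apply_eq_resLevel` —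
  g13's `resEmb K σ : K → ℂ` is `σ|_K` followed by `ℚ^{cm} ⊂ ℂ`), DEF `levelInclusion` (`K ⊂ K′` as a `ℚ`-algebra map for the `ℚ`-algebra structures
  instance search finds on levels), `restrictEmb_levelInclusion_resLevel` (`(σ|_{K′})|_K = σ|_K`), instance `isGalois_finiteGaloisLevel`;
* §2 **`lambdaLevel_eq_map_inflate_resLevel`: `Λ^K = (f ↦ f^{ℚ^{cm}})(X^*(S^K))`** for `[K : ℚ] < ∞` — `⊆`: a function on `Γ` in `I`, constant on the
  cosets, DESCENDS along the surjection `σ ↦ σ|_K` and the descent satisfies (1.1) because `F(σ) + F(ισ)` is constant and `ι` is central; `⊇`: `f^{ℚ^{cm}}`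
  is locally constant (`Gal(ℚ^{cm}/K)` is open) and (1.1) at the base point gives the constancy of `f(σ) + f(ισ)`.  DEF `levelChar K F = F|_K` (the
  unique preimage: `inflate_resLevel_levelChar`, `levelChar_eq_of_inflate_eq`, additive), **`levelChar_characterRep`** (`Γ`-equivariant, (1.3)),
  **`levelChar_mono`** (for `K ⊂ K′`: `F|_{K′} = inflateI (restrictEmb (K ⊂ K′)) (F|_K)` — going up a level is `X^*` of the norm map, Prop. 4.20),
  `weight_levelChar` (skel-3's `weight` at the base point `1|_K` is g13's `weightCM`), `levelChar_const_one` (`X^*(t)`), and DEF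
  **`extendLevel K : X^*(S^K) →ₗ[ℤ] X^*(S)`** (`extendLevel_injective`, `extendLevel_rep`, `exists_extendLevel_eq`: its image is `Λ^K`).

## Shape of the entries

* Vocabulary: g13-#2 `infinityTypesCM`, `resEmb`, `weightCM`; g13-#4 `lambdaLevel`, `infinityTypesCMRep`; skel-3 `infinityTypes`, `inflate`,
  `characterRep`, `weight`, `SerreGroupTorus.inflateI` / `infinityTypesRep` / `constChar`; the tree's `restrictEmb` and the scoped composition action of
  `EmbeddingAction`; Mathlib `FiniteGaloisIntermediateField`, `IntermediateField.fixingSubgroup`.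
* Implementation note (cf. g14 `SerreGroupLimitSplitting`): on a level `↥K` instance search finds the `ℚ`-algebra structure `DivisionRing.toRatAlgebra`,
  definitionally but not reducibly equal to the subalgebra structure; hence `levelInclusion` / `isGalois_finiteGaloisLevel` (re-typed by `exact`),
  base points written `resLevel K 1` rather than `K.val`, and underlying functions of characters written `g.1`.

## References

* [MilneCM2006] J. S. Milne, *Complex Multiplication* (course notes, 2006), Ch. I §4 pp. 40–43 (`I(K)`, `f ↦ f_L`, «The character group of `S`
  is `I`», Prop. 4.20, `t_K`).
* [MilneShih1982Taniyama] J. S. Milne, K.-y. Shih, *Langlands's construction of the Taniyama group*, LNM 900 (1982), Ch. III §1 (1.1)–(1.3)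
  (pp. 230–231).
* [Milne1999] J. S. Milne, *Lefschetz motives and the Tate conjecture*, Compositio Math. 117 (1999) 45–76, §5 p. 62 («the weight of g is the
  integer −g(ι) − g(1)»).

Provenance: lane `lit-hodgefound`, seat `lit-hodgefound-p27` gen 20 (agent `literature-prover-lit-hodgefound-p27-g20-0`), row g20-#3 FILE 1.
-/

set_option autoImplicit false

noncomputable section

open scoped IntermediateField

namespace Literature.NumberTheory.ComplexMultiplication

namespace CMNumbers

open Literature.NumberTheory.NumberFields (cmNumbers cmNumbersConj cmNumbersConj_mem_center)
open SerreGroupTorus (inflateI coe_inflateI_apply inflateI_apply_apply infinityTypesRep coe_infinityTypesRep_apply constChar coe_constChar)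
/-! ### §1 `σ ↦ σ|_K : Gal(ℚ^{cm}/ℚ) → Hom_ℚ(K, ℚ^{cm})` for a level `K ⊂ ℚ^{cm}` -/

section Levels

variable (K : IntermediateField ℚ cmNumbers)

/-- **`σ ↦ σ|_K`**, the restriction of `σ ∈ Γ = Gal(ℚ^{cm}/ℚ)` to a level `K ⊂ ℚ^{cm}` as a `ℚ`-embedding `K → ℚ^{cm}`, `Γ`-equivariant for left
multiplication on `Γ` and composition on embeddings («`f^L(τ) = f(τ|K)`»; g13-#2's `resEmb K σ` is this followed by `ℚ^{cm} ⊂ ℂ`,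
`resEmb_apply_eq_resLevel`). [cite: MilneCM2006, Ch. I §4 p. 40 («f_L(τ) = f(τ|K)»)] [cite: MilneShih1982Taniyama, III §1 (1.3) (p. 231)] -/
def resLevel : (cmNumbers ≃ₐ[ℚ] cmNumbers) →[cmNumbers ≃ₐ[ℚ] cmNumbers] (K →ₐ[ℚ] cmNumbers) where
  toFun σ := (σ : cmNumbers →ₐ[ℚ] cmNumbers).comp K.val
  map_smul' _ _ := rfl

/-- `(σ|_K)(x) = σ(x)`. [cite: MilneCM2006, Ch. I §4 p. 40] -/
@[simp] theorem resLevel_apply (σ : cmNumbers ≃ₐ[ℚ] cmNumbers) (x : K) : resLevel K σ x = σ x := rfl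

/-- `1|_K` is the inclusion `K ⊂ ℚ^{cm}` (the base point `φ₀`). [cite: MilneCM2006, Ch. I §4 p. 40 («the given inclusion φ₀»)] -/
theorem resLevel_one : resLevel K 1 = K.val := AlgHom.ext fun _ => rfl

/-- `σ|_K = σ · φ₀` for the composition action. [cite: MilneShih1982Taniyama, III §1 (1.3) (p. 231)] -/
theorem smul_val_eq_resLevel (σ : cmNumbers ≃ₐ[ℚ] cmNumbers) : σ • K.val = resLevel K σ := rfl

/-- `(στ)|_K = σ · (τ|_K)` (equivariance, as a rewrite rule). [cite: MilneShih1982Taniyama, III §1 (1.3) (p. 231)] -/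
theorem resLevel_mul (σ τ : cmNumbers ≃ₐ[ℚ] cmNumbers) : resLevel K (σ * τ) = σ • resLevel K τ := rfl

/-- g13-#2's `resEmb K σ : K → ℂ` is `σ|_K` followed by `ℚ^{cm} ⊂ ℂ`. [cite: MilneCM2006, Ch. I §4 p. 40] -/
theorem resEmb_apply_eq_resLevel (σ : cmNumbers ≃ₐ[ℚ] cmNumbers) (x : K) : resEmb K σ x = ((resLevel K σ x : cmNumbers) : ℂ) := rfl

/-- `(στ)|_K = σ|_K` for `τ ∈ Gal(ℚ^{cm}/K)`. [cite: MilneShih1982Taniyama, III §1 (1.3) (p. 231)] -/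
theorem resLevel_mul_of_mem_fixingSubgroup (σ : cmNumbers ≃ₐ[ℚ] cmNumbers) {τ : cmNumbers ≃ₐ[ℚ] cmNumbers}
    (hτ : τ ∈ K.fixingSubgroup) : resLevel K (σ * τ) = resLevel K σ := by
  refine AlgHom.ext fun x => ?_
  rw [resLevel_apply, resLevel_apply, AlgEquiv.mul_apply, (IntermediateField.mem_fixingSubgroup_iff _ _).mp hτ _ x.2]

/-- **The fibres of `σ ↦ σ|_K` are the left cosets of `Gal(ℚ^{cm}/K)`.** [cite: MilneShih1982Taniyama, III §1 (1.3) (p. 231)] -/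
theorem resLevel_eq_iff (σ σ' : cmNumbers ≃ₐ[ℚ] cmNumbers) : resLevel K σ = resLevel K σ' ↔ σ⁻¹ * σ' ∈ K.fixingSubgroup := by
  rw [IntermediateField.mem_fixingSubgroup_iff]
  constructor
  · intro h x hx
    have hx' := AlgHom.congr_fun h ⟨x, hx⟩
    simp only [resLevel_apply] at hx'
    rw [AlgEquiv.mul_apply, AlgEquiv.aut_inv, ← hx', AlgEquiv.symm_apply_apply]
  · intro h
    have h' : resLevel K (σ * (σ⁻¹ * σ')) = resLevel K σ :=
      resLevel_mul_of_mem_fixingSubgroup K σ ((IntermediateField.mem_fixingSubgroup_iff _ _).mpr h)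
    rw [mul_inv_cancel_left] at h'
    exact h'.symm

/-- **`σ ↦ σ|_K` is surjective**: every `ℚ`-embedding `K → ℚ^{cm}` extends to `ℚ^{cm}` (normal over `ℚ`; the tree's `exists_algEquiv_smul_eq`).
[cite: MilneCM2006, Ch. I §4 p. 40] -/
theorem resLevel_surjective : Function.Surjective (resLevel K) := fun φ => by
  obtain ⟨σ, hσ⟩ := exists_algEquiv_smul_eq (F := ℚ) (Ω := cmNumbers) K.val φ
  exact ⟨σ, hσ⟩

variable {K} in
/-- The inclusion of levels `K ⊂ K′` as a `ℚ`-algebra map (Mathlib's `IntermediateField.inclusion`, re-typed for the `ℚ`-algebra structures that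
instance search finds on the levels — see g14's implementation note in `SerreGroupLimitSplitting`). [cite: MilneCM2006, Ch. I §4 Prop. 4.20 («K ⊂ L»)] -/
def levelInclusion {K' : IntermediateField ℚ cmNumbers} (h : K ≤ K') : K →ₐ[ℚ] K' := by
  exact IntermediateField.inclusion h

variable {K} in
/-- `levelInclusion h x = x`. [cite: MilneCM2006, Ch. I §4 Prop. 4.20] -/
@[simp] theorem coe_levelInclusion_apply {K' : IntermediateField ℚ cmNumbers} (h : K ≤ K') (x : K) :
    ((levelInclusion h x : K') : cmNumbers) = x := rfl

variable {K} in
/-- Transition: for levels `K ⊂ K′`, `(σ|_{K′})|_K = σ|_K` — `restrictEmb (K ⊂ K′) ∘ resLevel K′ = resLevel K`.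
[cite: MilneCM2006, Ch. I §4 Prop. 4.20 («f ↦ f_L»)] -/
theorem restrictEmb_levelInclusion_resLevel {K' : IntermediateField ℚ cmNumbers} (h : K ≤ K') (σ : cmNumbers ≃ₐ[ℚ] cmNumbers) :
    restrictEmb (Ω := cmNumbers) (levelInclusion h) (resLevel K' σ) = resLevel K σ :=
  AlgHom.ext fun _ => rfl

/-- Instance plumbing (cf. g14 `normal_finiteGaloisLevel`): a finite Galois level `E ⊂ ℚ^{cm}` is Galois over `ℚ` also for the `ℚ`-algebra structure that
instance search finds on `↥E` (`DivisionRing.toRatAlgebra`, definitionally equal to the subalgebra structure carried by `E.isGalois`).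
[cite: MilneShih1982Taniyama, III §1 (p. 231)] -/
instance isGalois_finiteGaloisLevel (E : FiniteGaloisIntermediateField ℚ cmNumbers) : IsGalois ℚ (E : IntermediateField ℚ cmNumbers) := by
  exact E.isGalois

/-! ### §2 `X^*(S^K)` in the two vocabularies: `lambdaLevel K = inflate (resLevel K) '' infinityTypes Γ Hom(K, ℚ^{cm}) ι` -/

variable {K}

/-- `f^{ℚ^{cm}}(σ) = f(σ|_K)` for skel-3's `inflate` along `resLevel K`. [cite: MilneCM2006, Ch. I §4 p. 40 («f_L(τ) = f(τ|K)»)] -/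
theorem inflate_resLevel_apply (g : (K →ₐ[ℚ] cmNumbers) → ℤ) (σ : cmNumbers ≃ₐ[ℚ] cmNumbers) :
    inflate (resLevel K) g σ = g (resLevel K σ) := rfl

/-- `f ↦ f^{ℚ^{cm}}` is injective (`σ ↦ σ|_K` is onto). [cite: MilneShih1982Taniyama, III §1 (1.3) («identifies»)] -/
theorem inflate_resLevel_injective : Function.Injective (inflate (resLevel K)) := fun g g' h => by
  funext φ
  obtain ⟨σ, rfl⟩ := resLevel_surjective K φ
  exact congr_fun h σ

/-- `f^{ℚ^{cm}}` is locally constant when `[K : ℚ] < ∞` (constant on the cosets of the open `Gal(ℚ^{cm}/K)`). [cite: MilneCM2006, Ch. I §4 p. 40] -/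
theorem isLocallyConstant_inflate_resLevel [FiniteDimensional ℚ K] (g : (K →ₐ[ℚ] cmNumbers) → ℤ) :
    IsLocallyConstant (inflate (resLevel K) g) :=
  isLocallyConstant_of_forall_apply_mul_eq K fun σ τ hτ => by
    change g (resLevel K (σ * τ)) = g (resLevel K σ)
    rw [resLevel_mul_of_mem_fixingSubgroup K σ hτ]

/-- **`f^{ℚ^{cm}} ∈ I = X^*(S)` for `f ∈ X^*(S^K)`** (`[K : ℚ] < ∞`): (1.1) at the base point gives «`f(σ) + f(ισ)` independent of `σ`».
[cite: MilneCM2006, Ch. I §4 pp. 40, 42 («I = lim→ I(K)»)] [cite: MilneShih1982Taniyama, III §1 (1.1), (1.3)] -/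
theorem inflate_resLevel_mem_infinityTypesCM [FiniteDimensional ℚ K] {g : (K →ₐ[ℚ] cmNumbers) → ℤ}
    (hg : g ∈ infinityTypes (cmNumbers ≃ₐ[ℚ] cmNumbers) (K →ₐ[ℚ] cmNumbers) cmNumbersConj) :
    inflate (resLevel K) g ∈ infinityTypesCM := by
  refine (mem_infinityTypesCM_iff _).mpr ⟨isLocallyConstant_inflate_resLevel g, g K.val + g (cmNumbersConj⁻¹ • K.val), fun σ => ?_⟩
  have h := ((mem_infinityTypes_iff_forall g).mp hg).1 σ K.val
  have e1 : resLevel K σ = σ • K.val := rfl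
  have e2 : resLevel K (cmNumbersConj * σ) = cmNumbersConj⁻¹ • σ • K.val := by
    rw [cmNumbersConj_inv]; rfl
  rw [inflate_resLevel_apply, inflate_resLevel_apply, e1, e2]
  exact h

/-- `f^{ℚ^{cm}} ∈ Λ^K = X^*(S^K) ⊂ I` (g13-#4's `lambdaLevel K`). [cite: MilneShih1982Taniyama, III §1 (1.3) (p. 231)] -/
theorem inflate_resLevel_mem_lambdaLevel [FiniteDimensional ℚ K] {g : (K →ₐ[ℚ] cmNumbers) → ℤ}
    (hg : g ∈ infinityTypes (cmNumbers ≃ₐ[ℚ] cmNumbers) (K →ₐ[ℚ] cmNumbers) cmNumbersConj) :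
    inflate (resLevel K) g ∈ lambdaLevel K :=
  ⟨inflate_resLevel_mem_infinityTypesCM hg, fun σ τ hτ => by
    change g (resLevel K (σ * τ)) = g (resLevel K σ)
    rw [resLevel_mul_of_mem_fixingSubgroup K σ hτ]⟩

/-- **Conversely every `F ∈ Λ^K` is `f^{ℚ^{cm}}` for a unique `f ∈ X^*(S^K)`**: `F` descends along the surjection `σ ↦ σ|_K` (it is constant on
its fibres), and the descent satisfies (1.1) because `F(σ) + F(ισ)` is constant and `ι` is central. [cite: MilneShih1982Taniyama, III §1 (1.1), (1.3) (p. 231)] -/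
theorem exists_inflate_resLevel_eq {F : (cmNumbers ≃ₐ[ℚ] cmNumbers) → ℤ} (hF : F ∈ lambdaLevel K) :
    ∃ g ∈ infinityTypes (cmNumbers ≃ₐ[ℚ] cmNumbers) (K →ₐ[ℚ] cmNumbers) cmNumbersConj, inflate (resLevel K) g = F := by
  classical
  have key : ∀ σ σ' : cmNumbers ≃ₐ[ℚ] cmNumbers, resLevel K σ = resLevel K σ' → F σ = F σ' := fun σ σ' h => by
    rw [← hF.2 σ _ ((resLevel_eq_iff K σ σ').mp h), mul_inv_cancel_left]
  choose s hs using resLevel_surjective K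
  have hg : ∀ σ, F (s (resLevel K σ)) = F σ := fun σ => key _ _ (hs _)
  obtain ⟨-, w, hw⟩ := (mem_infinityTypesCM_iff F).mp hF.1
  have hc : ∀ ρ : cmNumbers ≃ₐ[ℚ] cmNumbers, ρ * cmNumbersConj = cmNumbersConj * ρ := fun ρ =>
    (Subgroup.mem_center_iff.mp cmNumbersConj_mem_center ρ)
  refine ⟨fun φ => F (s φ), ?_, funext fun σ => hg σ⟩
  rw [mem_infinityTypes_iff_forall]
  refine ⟨fun σ φ => ?_, fun σ φ => ?_⟩
  · obtain ⟨ρ, rfl⟩ := resLevel_surjective K φ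
    have e1 : σ • resLevel K ρ = resLevel K (σ * ρ) := rfl
    have e2 : cmNumbersConj⁻¹ • resLevel K (σ * ρ) = resLevel K (cmNumbersConj * (σ * ρ)) := by rw [cmNumbersConj_inv]; rfl
    have e3 : cmNumbersConj⁻¹ • resLevel K ρ = resLevel K (cmNumbersConj * ρ) := by rw [cmNumbersConj_inv]; rfl
    change F (s (σ • resLevel K ρ)) + F (s (cmNumbersConj⁻¹ • σ • resLevel K ρ)) = F (s (resLevel K ρ)) + F (s (cmNumbersConj⁻¹ • resLevel K ρ))
    rw [e1, e2, e3, hg, hg, hg, hg, hw, hw]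
  · obtain ⟨ρ, rfl⟩ := resLevel_surjective K φ
    have e1 : σ • resLevel K ρ = resLevel K (σ * ρ) := rfl
    have e2 : σ • cmNumbersConj⁻¹ • resLevel K ρ = resLevel K (cmNumbersConj * (σ * ρ)) := by
      rw [cmNumbersConj_inv, ← mul_assoc, ← hc σ, mul_assoc]; rfl
    have e3 : cmNumbersConj⁻¹ • resLevel K ρ = resLevel K (cmNumbersConj * ρ) := by rw [cmNumbersConj_inv]; rfl
    change F (s (σ • resLevel K ρ)) + F (s (σ • cmNumbersConj⁻¹ • resLevel K ρ)) = F (s (resLevel K ρ)) + F (s (cmNumbersConj⁻¹ • resLevel K ρ))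
    rw [e1, e2, e3, hg, hg, hg, hg, hw, hw]

/-- **`Λ^K = X^*(S^K)`, THE TWO VOCABULARIES AGREE**: g13-#4's `lambdaLevel K` is the image of skel-3's `infinityTypes Γ Hom(K, ℚ^{cm}) ι` under
`f ↦ f^{ℚ^{cm}}` (compare g13's `lambdaLevel_eq_map_extendInf`, the same through `Hom(K, ℂ)`). [cite: MilneShih1982Taniyama, III §1 (1.3) (p. 231)]
[cite: MilneCM2006, Ch. I §4 p. 42 («I = lim→ I(K)»)] -/
theorem lambdaLevel_eq_map_inflate_resLevel [FiniteDimensional ℚ K] :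
    lambdaLevel K = (infinityTypes (cmNumbers ≃ₐ[ℚ] cmNumbers) (K →ₐ[ℚ] cmNumbers) cmNumbersConj).map (inflate (resLevel K)) := by
  refine le_antisymm (fun F hF => ?_) ?_
  · obtain ⟨g, hg, rfl⟩ := exists_inflate_resLevel_eq hF
    exact ⟨g, hg, rfl⟩
  · rintro _ ⟨g, hg, rfl⟩
    exact inflate_resLevel_mem_lambdaLevel hg

variable (K)

/-- **`F ↦ F|_K`**: the character `f ∈ X^*(S^K)` with `f^{ℚ^{cm}} = F`, for `F ∈ Λ^K`. [cite: MilneShih1982Taniyama, III §1 (1.3) (p. 231)] -/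
def levelChar (F : (cmNumbers ≃ₐ[ℚ] cmNumbers) → ℤ) (hF : F ∈ lambdaLevel K) :
    infinityTypes (cmNumbers ≃ₐ[ℚ] cmNumbers) (K →ₐ[ℚ] cmNumbers) cmNumbersConj :=
  ⟨Classical.choose (exists_inflate_resLevel_eq hF), (Classical.choose_spec (exists_inflate_resLevel_eq hF)).1⟩

/-- `(F|_K)^{ℚ^{cm}} = F`. [cite: MilneShih1982Taniyama, III §1 (1.3) (p. 231)] -/
@[simp] theorem inflate_resLevel_levelChar (F : (cmNumbers ≃ₐ[ℚ] cmNumbers) → ℤ) (hF : F ∈ lambdaLevel K) :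
    inflate (resLevel K) (levelChar K F hF).1 = F :=
  (Classical.choose_spec (exists_inflate_resLevel_eq hF)).2

/-- `(F|_K)(σ|_K) = F(σ)`. [cite: MilneCM2006, Ch. I §4 p. 40 («f_L(τ) = f(τ|K)»)] -/
@[simp] theorem levelChar_apply_resLevel (F : (cmNumbers ≃ₐ[ℚ] cmNumbers) → ℤ) (hF : F ∈ lambdaLevel K) (σ : cmNumbers ≃ₐ[ℚ] cmNumbers) :
    (levelChar K F hF).1 (resLevel K σ) = F σ :=
  congr_fun (inflate_resLevel_levelChar K F hF) σ

variable {K}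

/-- Uniqueness of `F|_K`. [cite: MilneShih1982Taniyama, III §1 (1.3) («identifies»)] -/
theorem levelChar_eq_of_inflate_eq {F : (cmNumbers ≃ₐ[ℚ] cmNumbers) → ℤ} (hF : F ∈ lambdaLevel K)
    (g : infinityTypes (cmNumbers ≃ₐ[ℚ] cmNumbers) (K →ₐ[ℚ] cmNumbers) cmNumbersConj)
    (h : inflate (resLevel K) g.1 = F) : levelChar K F hF = g :=
  Subtype.ext (inflate_resLevel_injective (by rw [inflate_resLevel_levelChar, h]))

/-- `(f^{ℚ^{cm}})|_K = f`. [cite: MilneShih1982Taniyama, III §1 (1.3) (p. 231)] -/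
theorem levelChar_inflate_resLevel [FiniteDimensional ℚ K] (g : infinityTypes (cmNumbers ≃ₐ[ℚ] cmNumbers) (K →ₐ[ℚ] cmNumbers) cmNumbersConj) :
    levelChar K (inflate (resLevel K) g.1) (inflate_resLevel_mem_lambdaLevel g.2) = g :=
  levelChar_eq_of_inflate_eq _ g rfl

/-- `F ↦ F|_K` is additive. [cite: MilneShih1982Taniyama, III §1 (1.3) (p. 231)] -/
theorem levelChar_add (F G : (cmNumbers ≃ₐ[ℚ] cmNumbers) → ℤ) (hF : F ∈ lambdaLevel K) (hG : G ∈ lambdaLevel K) :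
    levelChar K (F + G) (add_mem hF hG) = levelChar K F hF + levelChar K G hG :=
  levelChar_eq_of_inflate_eq _ _ (by rw [Submodule.coe_add, map_add, inflate_resLevel_levelChar, inflate_resLevel_levelChar])

/-- `0|_K = 0`. [cite: MilneShih1982Taniyama, III §1 (1.3) (p. 231)] -/
theorem levelChar_zero : levelChar K 0 (zero_mem _) = 0 :=
  levelChar_eq_of_inflate_eq _ _ (by rw [Submodule.coe_zero, map_zero])

/-- **`F ↦ F|_K` is `Γ`-equivariant** («transport of structure», (1.3)). [cite: MilneShih1982Taniyama, III §1 (1.3) (p. 231)] -/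
theorem levelChar_characterRep (σ : cmNumbers ≃ₐ[ℚ] cmNumbers) (F : (cmNumbers ≃ₐ[ℚ] cmNumbers) → ℤ) (hF : F ∈ lambdaLevel K) :
    levelChar K (characterRep (cmNumbers ≃ₐ[ℚ] cmNumbers) (cmNumbers ≃ₐ[ℚ] cmNumbers) σ F) (characterRep_mem_lambdaLevel K σ hF) =
      infinityTypesRep (cmNumbers ≃ₐ[ℚ] cmNumbers) (K →ₐ[ℚ] cmNumbers) cmNumbersConj σ (levelChar K F hF) :=
  levelChar_eq_of_inflate_eq _ _ (by rw [coe_infinityTypesRep_apply, inflate_characterRep, inflate_resLevel_levelChar])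

/-- **GOING UP A LEVEL IS `X^*(Nm)`**: for `K ⊂ K′` and `F ∈ Λ^K ⊂ Λ^{K′}`, `F|_{K′} = (F|_K) ∘ (·|_K) = inflateI (restrictEmb (K ⊂ K′)) (F|_K)`.
[cite: MilneCM2006, Ch. I §4 Prop. 4.20 («f ↦ f_L : I(K) → I(L) gives rise to the map Nm_{L/K}»)] -/
theorem levelChar_mono {K' : IntermediateField ℚ cmNumbers} (h : K ≤ K') (F : (cmNumbers ≃ₐ[ℚ] cmNumbers) → ℤ) (hF : F ∈ lambdaLevel K) :
    levelChar K' F (lambdaLevel_mono h hF) =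
      inflateI cmNumbersConj (restrictEmb (Ω := cmNumbers) (levelInclusion h)) (levelChar K F hF) :=
  levelChar_eq_of_inflate_eq _ _ (by
    funext σ
    rw [inflate_apply, coe_inflateI_apply, inflate_apply, restrictEmb_levelInclusion_resLevel h, levelChar_apply_resLevel])

/-- The constant function `1` lies in every `Λ^K` (it is `X^*` of `t : S → 𝔾_m`). [cite: MilneCM2006, Ch. I §4 p. 43 («t_K : S^K → 𝔾_m, m ↦ m : ℤ → I(K)»)] -/
theorem const_one_mem_lambdaLevel : (fun _ : cmNumbers ≃ₐ[ℚ] cmNumbers => (1 : ℤ)) ∈ lambdaLevel K :=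
  ⟨(mem_infinityTypesCM_iff _).mpr ⟨IsLocallyConstant.const 1, 2, fun _ => rfl⟩, fun _ _ _ => rfl⟩

/-- `1|_K` is skel-3's constant character `1 = X^*(t_K)(1)`. [cite: MilneCM2006, Ch. I §4 p. 43] -/
theorem levelChar_const_one :
    levelChar K (fun _ : cmNumbers ≃ₐ[ℚ] cmNumbers => (1 : ℤ)) const_one_mem_lambdaLevel =
      constChar (cmNumbers ≃ₐ[ℚ] cmNumbers) (K →ₐ[ℚ] cmNumbers) cmNumbersConj 1 :=
  levelChar_eq_of_inflate_eq _ _ (funext fun _ => rfl)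

variable (K) in
/-- **Milne's weight of `F|_K` (at the base point `φ₀ = 1|_K`, the inclusion `K ⊂ ℚ^{cm}`) is g13's `weightCM F`** — both are `−(F(1) + F(ι))`.
[cite: MilneCM2006, Ch. I §4 p. 43 («t ∘ w = −2»)] [cite: Milne1999, §5 p. 62 («the weight of g is the integer −g(ι) − g(1)»)] -/
theorem weight_levelChar (F : (cmNumbers ≃ₐ[ℚ] cmNumbers) → ℤ) (hF : F ∈ lambdaLevel K) :
    weight cmNumbersConj (resLevel K 1) (levelChar K F hF).1 = weightCM F := by
  have h2 : (levelChar K F hF).1 (cmNumbersConj • resLevel K 1) = F cmNumbersConj := by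
    rw [← resLevel_mul, mul_one, levelChar_apply_resLevel]
  change -((levelChar K F hF).1 (resLevel K 1) + (levelChar K F hF).1 (cmNumbersConj • resLevel K 1)) = _
  rw [levelChar_apply_resLevel, h2, weightCM_apply]

variable (K)

/-- **`X^*(S^K) ↪ X^*(S)`, `f ↦ f^{ℚ^{cm}}`** as a `ℤ`-linear map into g13-#2's `infinityTypesCM` (`[K : ℚ] < ∞`); its image is `Λ^K`.
[cite: MilneCM2006, Ch. I §4 pp. 40, 42 («I = lim→ I(K)»)] -/
def extendLevel [FiniteDimensional ℚ K] :
    infinityTypes (cmNumbers ≃ₐ[ℚ] cmNumbers) (K →ₐ[ℚ] cmNumbers) cmNumbersConj →ₗ[ℤ] infinityTypesCM :=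
  LinearMap.codRestrict infinityTypesCM ((inflate (resLevel K)).comp (Submodule.subtype _))
    fun g => inflate_resLevel_mem_infinityTypesCM g.2

/-- Underlying function of `extendLevel K g`. [cite: MilneCM2006, Ch. I §4 p. 40] -/
@[simp] theorem coe_extendLevel [FiniteDimensional ℚ K] (g : infinityTypes (cmNumbers ≃ₐ[ℚ] cmNumbers) (K →ₐ[ℚ] cmNumbers) cmNumbersConj) :
    ((extendLevel K g : infinityTypesCM) : (cmNumbers ≃ₐ[ℚ] cmNumbers) → ℤ) = inflate (resLevel K) g.1 := rfl

/-- `extendLevel K g ∈ Λ^K`. [cite: MilneShih1982Taniyama, III §1 (1.3) (p. 231)] -/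
theorem extendLevel_mem_lambdaLevel [FiniteDimensional ℚ K] (g : infinityTypes (cmNumbers ≃ₐ[ℚ] cmNumbers) (K →ₐ[ℚ] cmNumbers) cmNumbersConj) :
    ((extendLevel K g : infinityTypesCM) : (cmNumbers ≃ₐ[ℚ] cmNumbers) → ℤ) ∈ lambdaLevel K :=
  inflate_resLevel_mem_lambdaLevel g.2

/-- `f ↦ f^{ℚ^{cm}}` is injective. [cite: MilneShih1982Taniyama, III §1 (1.3) («identifies»)] -/
theorem extendLevel_injective [FiniteDimensional ℚ K] : Function.Injective (extendLevel K) := fun _ _ h =>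
  Subtype.ext (inflate_resLevel_injective (congrArg (fun F : infinityTypesCM => (F : (cmNumbers ≃ₐ[ℚ] cmNumbers) → ℤ)) h))

/-- `(f^{ℚ^{cm}})|_K = f`. [cite: MilneShih1982Taniyama, III §1 (1.3) (p. 231)] -/
theorem levelChar_extendLevel [FiniteDimensional ℚ K] (g : infinityTypes (cmNumbers ≃ₐ[ℚ] cmNumbers) (K →ₐ[ℚ] cmNumbers) cmNumbersConj) :
    levelChar K ((extendLevel K g : infinityTypesCM) : (cmNumbers ≃ₐ[ℚ] cmNumbers) → ℤ) (extendLevel_mem_lambdaLevel K g) = g :=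
  levelChar_eq_of_inflate_eq _ g rfl

/-- `(F|_K)^{ℚ^{cm}} = F` in `X^*(S)`. [cite: MilneShih1982Taniyama, III §1 (1.3) (p. 231)] -/
theorem extendLevel_levelChar [FiniteDimensional ℚ K] (F : infinityTypesCM)
    (hF : (F : (cmNumbers ≃ₐ[ℚ] cmNumbers) → ℤ) ∈ lambdaLevel K) : extendLevel K (levelChar K F hF) = F :=
  Subtype.ext (inflate_resLevel_levelChar K _ hF)

/-- Every `F ∈ Λ^K` is in the image of `extendLevel K`. [cite: MilneCM2006, Ch. I §4 p. 42 («I = lim→ I(K)»)] -/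
theorem exists_extendLevel_eq [FiniteDimensional ℚ K] (F : infinityTypesCM) (hF : (F : (cmNumbers ≃ₐ[ℚ] cmNumbers) → ℤ) ∈ lambdaLevel K) :
    ∃ g, extendLevel K g = F :=
  ⟨levelChar K F hF, extendLevel_levelChar K F hF⟩

/-- `f ↦ f^{ℚ^{cm}}` is `Γ`-equivariant. [cite: MilneShih1982Taniyama, III §1 (1.3) (p. 231)] -/
theorem extendLevel_rep [FiniteDimensional ℚ K] (σ : cmNumbers ≃ₐ[ℚ] cmNumbers)
    (g : infinityTypes (cmNumbers ≃ₐ[ℚ] cmNumbers) (K →ₐ[ℚ] cmNumbers) cmNumbersConj) :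
    extendLevel K (infinityTypesRep (cmNumbers ≃ₐ[ℚ] cmNumbers) (K →ₐ[ℚ] cmNumbers) cmNumbersConj σ g) =
      infinityTypesCMRep σ (extendLevel K g) :=
  Subtype.ext (by rw [coe_extendLevel, coe_infinityTypesRep_apply, inflate_characterRep, coe_infinityTypesCMRep_apply, coe_extendLevel])

end Levels

end CMNumbers

end Literature.NumberTheory.ComplexMultiplication
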